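import Summits.AtomisticToContinuum.Crystallization.Theorems.FreeSplittingCertificatesStrictSplittingRuleTorusQForm

/-!
# Sparse quadratic forms: the term-list form over any ordered field (e.g. `ℝ`) — companion of `…TorusQForm.lean`

Route `FreeSplittingCertificates`, crux `StrictSplittingRule` (stmt-AtomisticToContinuum-12560), unit b2b-freesplit-B
(block 2b, PART B, gen 1).  VALUE = certificate infrastructure for a FINITE model — not summit progress.

The certificates of the torus model are rational, but the displacement fields of `CoreJointSiteIneq` are real.  Here
`LinF.evalR` / `evalQR` evaluate the SAME term lists at `u : Fin N → R` for any linearly ordered field `R` (coefficients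
cast), `evalQR_eq_quadForm` is the Gram identity over `R`, and `evalQR_nonneg_of_certDD` turns ONE rational certificate
`PSD.IsGramCertDD` (whose trusted soundness lemma `IsGramCertDD.quadForm_nonneg` is already stated over `R`) into
nonnegativity of the form at every `R`-valued field.  [folklore]
-/

namespace Summit.AtomisticToContinuum.Crystallization.Theorems.StrictSplittingRuleTorusLMI

open Literature.Computation.Certificates

variable {N : ℕ}

section OverField

variable {R : Type*} [Field R] [LinearOrder R] [IsStrictOrderedRing R]

/-- Value of a sparse functional at an `R`-valued field `u` (coefficients cast). [folklore] -/
def LinF.evalR (ℓ : LinF N) (u : Fin N → R) : R := (ℓ.map fun p => (p.2 : R) * u p.1).sum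

omit [LinearOrder R] [IsStrictOrderedRing R] in
/-- `evalR`, nil case. [folklore] -/
@[simp] theorem LinF.evalR_nil (u : Fin N → R) : LinF.evalR ([] : LinF N) u = 0 := rfl

omit [LinearOrder R] [IsStrictOrderedRing R] in
/-- `evalR`, cons case. [folklore] -/
@[simp] theorem LinF.evalR_cons (p : Fin N × ℚ) (ℓ : LinF N) (u : Fin N → R) :
    LinF.evalR (p :: ℓ) u = (p.2 : R) * u p.1 + LinF.evalR ℓ u := by
  simp [LinF.evalR]

/-- **A sparse functional is the linear form of its (cast) coefficient vector.** [folklore] -/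
theorem LinF.evalR_eq_sum_coeff (ℓ : LinF N) (u : Fin N → R) : LinF.evalR ℓ u = ∑ i, (LinF.coeff ℓ i : R) * u i := by
  induction ℓ with
  | nil => simp
  | cons p ℓ ih =>
    rw [LinF.evalR_cons, ih]
    simp only [LinF.coeff_cons, Rat.cast_add, add_mul, Finset.sum_add_distrib]
    congr 1
    rw [Finset.sum_eq_single p.1]
    · simp
    · intro b _ hb; simp [Ne.symm hb]
    · simp

/-- `evalQR ts u = Σ_{(c, ℓ, ℓ') ∈ ts} c · ℓ(u) · ℓ'(u)` at an `R`-valued field. [folklore] -/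
def evalQR (ts : List (Term N)) (u : Fin N → R) : R :=
  (ts.map fun t => (t.1 : R) * t.2.1.evalR u * t.2.2.evalR u).sum

omit [LinearOrder R] [IsStrictOrderedRing R] in
/-- `evalQR`, nil case. [folklore] -/
@[simp] theorem evalQR_nil (u : Fin N → R) : evalQR ([] : List (Term N)) u = 0 := rfl

omit [LinearOrder R] [IsStrictOrderedRing R] in
/-- `evalQR`, cons case. [folklore] -/
@[simp] theorem evalQR_cons (t : Term N) (ts : List (Term N)) (u : Fin N → R) :
    evalQR (t :: ts) u = (t.1 : R) * t.2.1.evalR u * t.2.2.evalR u + evalQR ts u := by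
  simp [evalQR]

omit [LinearOrder R] [IsStrictOrderedRing R] in
/-- `evalQR` is additive under concatenation. [folklore] -/
@[simp] theorem evalQR_append (ts ts' : List (Term N)) (u : Fin N → R) :
    evalQR (ts ++ ts') u = evalQR ts u + evalQR ts' u := by
  simp [evalQR, List.map_append, List.sum_append]

/-- One weighted product as a quadratic form of its rank-one Gram matrix, over `R`. [folklore] -/
theorem term_quadFormR (c : ℚ) (ℓ ℓ' : LinF N) (u : Fin N → R) :
    (c : R) * ℓ.evalR u * ℓ'.evalR u = ∑ i, ∑ j, u i * ((c * ℓ.coeff i * ℓ'.coeff j : ℚ) : R) * u j := by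
  rw [LinF.evalR_eq_sum_coeff, LinF.evalR_eq_sum_coeff]
  simp_rw [Finset.mul_sum, Finset.sum_mul]
  rw [Finset.sum_comm]
  refine Finset.sum_congr rfl fun i _ => Finset.sum_congr rfl fun j _ => ?_
  push_cast
  ring

/-- **The Gram identity over `R`**: `evalQR ts u = ∑ i j, u i · (gramFun ts i j : R) · u j`. [folklore] -/
theorem evalQR_eq_quadForm (ts : List (Term N)) (u : Fin N → R) :
    evalQR ts u = ∑ i, ∑ j, u i * (gramFun ts i j : R) * u j := by
  induction ts with
  | nil => simp
  | cons t ts ih =>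
    rw [evalQR_cons, ih, gramFun_cons, term_quadFormR, ← Finset.sum_add_distrib]
    refine Finset.sum_congr rfl fun i _ => ?_
    rw [← Finset.sum_add_distrib]
    refine Finset.sum_congr rfl fun j _ => ?_
    push_cast
    ring

/-- Symmetrisation does not change the quadratic form (cast version). [folklore] -/
theorem quadForm_symmR (M : Matrix (Fin N) (Fin N) ℚ) (u : Fin N → R) :
    ∑ i, ∑ j, u i * (symm M i j : R) * u j = ∑ i, ∑ j, u i * (M i j : R) * u j := by
  have hT : ∑ i, ∑ j, u i * (M j i : R) * u j = ∑ i, ∑ j, u i * (M i j : R) * u j := by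
    rw [Finset.sum_comm]
    exact Finset.sum_congr rfl fun i _ => Finset.sum_congr rfl fun j _ => by ring
  have h2 : ∀ i j, u i * (symm M i j : R) * u j =
      (1 / 2) * (u i * (M i j : R) * u j) + (1 / 2) * (u i * (M j i : R) * u j) := by
    intro i j; simp only [symm]; push_cast; ring
  simp_rw [h2, Finset.sum_add_distrib, ← Finset.mul_sum, hT]
  ring

/-- **Glue over `R`**: a rational rounded Gram certificate of the symmetrised assembled matrix makes the term-list form
nonnegative at every `R`-valued field (e.g. real displacement fields). [folklore] -/
theorem evalQR_nonneg_of_certDD {ts : List (Term N)} {m : ℕ} {A : Matrix (Fin N) (Fin N) ℚ}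
    {d : Fin m → ℚ} {B : Matrix (Fin m) (Fin N) ℚ} (hA : A = symm (assemble ts).toMatrix)
    (h : PSD.IsGramCertDD A d B) (u : Fin N → R) : 0 ≤ evalQR ts u := by
  have h0 := h.quadForm_nonneg (R := R) u
  rw [hA, quadForm_symmR, toMatrix_assemble, ← evalQR_eq_quadForm] at h0
  exact h0

end OverField

end Summit.AtomisticToContinuum.Crystallization.Theorems.StrictSplittingRuleTorusLMI
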